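import Summits.Ventures.QEC.Census.CertCoverBatch
import Summits.Ventures.QEC.Census.BB.A1s_n192_k8_200fbf07.CoreDefs
import HarnessLib

set_option Elab.async false
set_option maxRecDepth 200000

/-!
# `[[192,8,16]]` one-level cover certificate of `A1s_n192_k8_200fbf07` — LEVEL-1→0 coset problems 0…28 (deep problems [1] excluded: `ProbDeep*.lean`) as COMPACT data
(`ProbData`: U, f, σ, y₀, allow; qec-type-10 `CertCoverBatch.mkCoset` rebuilds each `CosetProb` in the kernel) + their verdict
`probsOK cov covR hx hx1 D1 lxd 14` (one `decide +kernel`; 28 problems, depths f=0:16 f=1:8 f=2:4 f=3:0, est. 280.0 s).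
qec-search-1 g5 (pattern of search-9 g5 `Probs*`); data from JSON `level10.problems` (sha256 559783b31acf5d05…). Data + decided check; KERNEL.
-/

namespace Summit.Ventures.QEC.Census.A1s_n192_k8_200fbf07

open Matrix Summit.Ventures.QEC.Census Literature.InformationTheory.QuantumCodes

/-- Problems 0…28 (28): `⟨U, f, σ, y₀, allow⟩`. -/
def probs00 : List ProbData := [
    ⟨5911116345558529, 1, 177408, 141733971456, [0]⟩,
    ⟨4727126787746860892222, 0, 141733924864, 4722366482875097810846, []⟩,
    ⟨5902959088784912683136, 2, 141784277761, 4722367327294575345664, [0, 39614081257132168796771975168]⟩,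
    ⟨5905338396727715037215, 0, 141784254465, 5902958244324632952862, []⟩,
    ⟨7083553102075097268736, 2, 141734022147, 4722369860569399296000, [0, 9444732965739290427392]⟩,
    ⟨7083556761391561999361, 0, 141734131971, 2361183241647431910400, [0]⟩,
    ⟨8854437507277462177856, 0, 141750706433, 4722366764344621924352, [0]⟩,
    ⟨14167102263358753104640, 2, 425201846784, 25344, [0, 1125899906842624]⟩,
    ⟨23611835510714754163457, 0, 708669696768, 23611835510573020217345, [0]⟩,
    ⟨23611840858597611316480, 1, 708669857280, 18889472686878089027840, [0]⟩,
    ⟨23611847051330633935106, 0, 708670043136, 283467917568, [0]⟩,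
    ⟨23686321954392547827904, 0, 708672864256, 73786978500640022648, []⟩,
    ⟨25973021285353558951424, 0, 708669772803, 2361183241505698006528, [0]⟩,
    ⟨33056567350554104176897, 1, 992137504512, 141733929216, [0]⟩,
    ⟨33056570446637214787328, 0, 992137597440, 59136, [0]⟩,
    ⟨34237157704669541175425, 0, 992187793921, 33056565943037469917185, [0]⟩,
    ⟨35417755376992722650112, 1, 992137648131, 2361183241505697989632, [0]⟩,
    ⟨42501313545475700369664, 1, 1275605743104, 76032, [0]⟩,
    ⟨42501325930941745606916, 0, 1275606082048, 566935826688, [0]⟩,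
    ⟨54307228063870811703296, 1, 1559073533955, 14167099448608935708672, [0]⟩,
    ⟨80280244283099890919684, 0, 2409477075456, 80280244282532955160580, [0]⟩,
    ⟨80280258919231878476032, 1, 2409477481984, 143616, [0]⟩,
    ⟨80280288193763596304648, 0, 2409478295040, 1133871628544, [0]⟩,
    ⟨81460849836297268887680, 0, 2409527771905, 1180591761490337464448, [0]⟩,
    ⟨92086173437626989809664, 1, 2692945305603, 2361183241505698091008, [0]⟩,
    ⟨155838149666744234672384, 2, 4402343052800, 262400, [0, 8192]⟩,
    ⟨156732761047561977364736, 0, 4402349867009, 156428389750640459282432, []⟩,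
    ⟨165282883758383465513728, 0, 4685810993664, 165282883758383465234432, [0]⟩]

set_option maxHeartbeats 400000000 in
/-- Every problem of this chunk passes (`mkCoset` elimination + `cosetOKD` + fast `σ` + depth + `BU`-evenness + label checks). -/
theorem probs00_ok : probsOK A1s_n192_k8_200fbf07.cov covR hx hx1 D1 lxd 14 probs00 = true := by
  decide +kernel

/-- Pointwise form. -/
theorem probs00_all : ∀ x ∈ A1s_n192_k8_200fbf07.probs00, probOK cov covR hx hx1 D1 lxd 14 x = true := by
  have h := probs00_ok
  rwa [probsOK, List.all_eq_true] at h

end Summit.Ventures.QEC.Census.A1s_n192_k8_200fbf07
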